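import Summits.ABC.IUTFork.Cor312PilotIdelesPrCapstone
import HarnessLib

/-!
# [IUTchIII] Corollary 3.12 at the print-normalised assembled real setting — NON-VACUITY of the idele binders:
# realising ideles EXIST whenever `2l ∣ ord_v(q_v)` on `S`, and then every conclusion of the capstone holds for them

PROOF-ONLY record file (D-0012; no definitions) of the abc-iut cell (Cor. 3.12 sub-crew, seat abc-iut-c312-7, gen 3;
D-0067 TEAM A row A-0 coda «A-0 AT THE PRINT-NORMALISED SETTING»); TAKES NO SIDE. Vacuity audit (cell rule "vacuity-audit
every fork-level hypothesis with a non-vacuity witness", LANA Rem. 8.2.1 discipline) of the hypotheses of this seat's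
`Cor312PilotIdelesPrCapstone` (p424856): the Θ-ideles `t` and `q`-ideles `tq` must be non-zero, units off `S`, and `tq`
must realise `P_q` in Dupuy–Hilado's normalisation (3.4), `log ‖t_{q,v}‖ = −P_q(v)·ln|κ(v)|/n_v`. abc-iut-c312-3 (gen 4)
proved (`Cor312PilotIdelesCapstone` §3, `exists_realising_thetaIdeles` / `exists_realising_qIdeles`) that such ideles EXIST
as soon as `2l ∣ ord_v(q_v)` at every `v ∈ S` — for a collection of initial Θ-data this is [IUTchI] Ex. 3.2 (iv)
("`q̲_v = q_v^{1/2l} ∈ K_v̲`", kurims `paper:url-690e7b3c6199` p. 71) with `F` here in the role of `K`. THIS file composes: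

* `qIdele_norm_eq_one_of_realises` — a `q`-idele realising `P_q` is a unit off `S` (`P_q` is supported on `S`; the
  `q`-side twin of abc-iut-c312-3's `norm_eq_one_of_realises`);
* **`exists_ideles_settingPrVolSharp`** — under `2l ∣ ord_v(q_v)` on `S` there are ideles `t`, `tq` meeting EVERY binder
  of the capstone, and for the resulting setting `P := settingPrVolSharp … tq t …` ALL of: `P.ThetaFinite`,
  `BridgeHyps P`, `ThetaRegionsAdm P`, `P.negLogQ = −FinDivisor.ndeg F X.qPilot`, `P.AbsLogQPos`, and
  `P.Statement ↔ ↑(−FinDivisor.ndeg F X.qPilot) ≤ P.negLogTheta` — so the print-normalised A-0 chain is about an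
  INHABITED family of settings, for every pilot datum `X` with the divisibility, every analytic logarithm family, and
  every choice of the free context binders (column `n`, lattice/signature/`q`-pilot data, archimedean and (b)(c) data).
[claim: Mochizuki2012, status: disputed] for the quoted setting; [cite: Mochizuki2012, IUTchI Ex. 3.2 (iv) p. 71];
[cite: DupuyHilado2025, §3.3, §3.4, §3.9]. HONEST FRAMING: an existence statement about OUR binders; nothing here bears
on `−|log(Θ)|` versus `−|log(q)|`. typed ≠ proved; instantiated ≠ endorsed.
-/

noncomputable section

open Set Function NumberField IsDedekindDomain
open scoped Pointwise

namespace Summit.ABC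

namespace IUTFork

namespace Thm311

namespace Real

open Cor312 Cor312Vol Literature.IUT.LogThetaLattice Literature.IUT.LogVolume

variable {F : Type} [Field F] [NumberField F] (X : PilotData F) {logv : PadicLogs F} (hlog : LogvAnalytic logv)

/-- **A `q`-idele realising `P_q` is a unit off `S`**: `P_q(v) = 0` for `v ∉ S`, so `log ‖t_{q,v}‖ = 0` and (`t_{q,v} ≠ 0`)
`‖t_{q,v}‖ = 1` — the `q`-side twin of abc-iut-c312-3's `norm_eq_one_of_realises`. [cite: DupuyHilado2025, §3.3, §3.4] -/
theorem qIdele_norm_eq_one_of_realises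
    (tq : ∀ (pp : Nat.Primes) (x : (thetaIndex X).Fibre (.inr pp)), haveI : Fact (pp : ℕ).Prime := ⟨pp.2⟩; kOf X pp.1 x)
    (htq0 : ∀ pp x, tq pp x ≠ 0)
    (htq : ∀ (pp : Nat.Primes) (x : (thetaIndex X).Fibre (.inr pp)),
      haveI : Fact (pp : ℕ).Prime := ⟨pp.2⟩
      Real.log ‖tq pp x‖ = -(X.qPilot (placeOf X pp.1 x)) * logNorm F (placeOf X pp.1 x) /
        localDegree F (placeOf X pp.1 x))
    (pp : Nat.Primes) (x : (thetaIndex X).Fibre (.inr pp))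
    (hx : haveI : Fact (pp : ℕ).Prime := ⟨pp.2⟩; placeOf X pp.1 x ∉ X.S) :
    haveI : Fact (pp : ℕ).Prime := ⟨pp.2⟩; ‖tq pp x‖ = 1 := by
  haveI : Fact (pp : ℕ).Prime := ⟨pp.2⟩
  have h := htq pp x
  rw [X.qPilot_apply_of_not_mem hx, neg_zero, zero_mul, zero_div] at h
  rcases Real.log_eq_zero.mp h with h0 | h1 | hm1
  · exact absurd (norm_eq_zero.mp h0) (htq0 pp x)
  · exact h1
  · exact absurd hm1 (by have := norm_nonneg (tq pp x); intro h'; linarith)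

variable (M : Type) [Field M] [NumberField M]
  (archPk : ∀ (j : (thetaIndex X).Label) (vQ : (thetaIndex X).VQ), Set ((logShellsDH X logv).Packet j vQ))
  (archSub : ∀ (j : (thetaIndex X).Label) (v : (thetaIndex X).V),
    Set ((logShellsDH X logv).Packet j ((thetaIndex X).over v)))
  (Ψ : ℤ → ∀ v : (thetaIndex X).V, v ∈ (thetaIndex X).Vbad → Set ((logShellsDH X logv).StarPacket v))
  (act : ℤ → ∀ v : (thetaIndex X).V, v ∈ (thetaIndex X).Vbad →
    (logShellsDH X logv).StarPacket v → Module.End ℚ ((logShellsDH X logv).StarPacket v))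
  (Mmod : ℤ → ∀ j : (thetaIndex X).LabelStar, Set ((logShellsDH X logv).GlobalPacket j.1))
  (region : ℤ → ∀ j : (thetaIndex X).LabelStar, FinDivisor M → ∀ vQ : (thetaIndex X).VQ,
    Set ((logShellsDH X logv).Packet j.1 vQ))
  (n : ℤ) {HT : Type} {LogLink : HT → HT → Type} {IsFull : ∀ {s t : HT}, LogLink s t → Prop}
  (lat : LGPGaussianLogThetaLattice LogLink IsFull)
  {Frd : Type} {IsoF : Frd → Frd → Type} {Ob : Frd → Type} {realify : Frd → Frd} {Strip : Type}
  {IsoS : Strip → Strip → Type} {Mv : ∀ v : (thetaIndex X).V, v ∈ (thetaIndex X).Vbad → Type}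
  [∀ v h, Monoid (Mv v h)]
  (sig : GlobalLGPFrobenioidSignature (thetaIndex X).lstar (thetaIndex X).V (· ∈ (thetaIndex X).Vbad)
    Frd IsoF Ob realify Strip IsoS Mv)
  (split : SplittingMonoids Mv) {ObΔ : Type} {N : ∀ v : (thetaIndex X).V, v ∈ (thetaIndex X).Vbad → Type}
  [∀ v h, Monoid (N v h)] (qData : QPilotData ObΔ N)

/-- **NON-VACUITY OF THE PRINT-NORMALISED A-0 CHAIN**: if `2l ∣ ord_v(q_v)` at every `v ∈ S` ([IUTchI] Ex. 3.2 (iv) with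
`F` in the role of `K`), there EXIST Θ-ideles `t` and `q`-ideles `tq` meeting every binder of this seat's capstone
(non-zero; units off `S`; `tq` realising `P_q`, and `t` realising `P_Θ`), and for the print-normalised assembled real
setting with the pilot regions read off THESE ideles all conclusions hold at once: "`−|log(Θ)| ∈ ℝ`", every field of
abc-iut-c312-6's `BridgeHyps`, admissibility of every Kummer image, `−|log(q)| = −deĝ(P_q)`, "`|log(q)| > 0`", and the
residue `Statement ↔ ↑(−deĝ(P_q)) ≤ −|log(Θ)|`. [claim: Mochizuki2012, status: disputed] -/
theorem exists_ideles_settingPrVolSharp (hdiv : ∀ v ∈ X.S, (2 * X.l : ℤ) ∣ X.ordq v) :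
    ∃ (t : ∀ (pp : Nat.Primes) (_ : Fin X.lstar) (x : (thetaIndex X).Fibre (.inr pp)),
          haveI : Fact (pp : ℕ).Prime := ⟨pp.2⟩; kOf X pp.1 x)
      (tq : ∀ (pp : Nat.Primes) (x : (thetaIndex X).Fibre (.inr pp)), haveI : Fact (pp : ℕ).Prime := ⟨pp.2⟩; kOf X pp.1 x)
      (_ : ∀ pp i x, t pp i x ≠ 0)
      (_ : ∀ (pp : Nat.Primes) (i : Fin X.lstar) (x : (thetaIndex X).Fibre (.inr pp)),
          haveI : Fact (pp : ℕ).Prime := ⟨pp.2⟩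
          Real.log ‖t pp i x‖ = -(X.thetaPilot i (placeOf X pp.1 x)) * logNorm F (placeOf X pp.1 x) /
            localDegree F (placeOf X pp.1 x))
      (htq0 : ∀ pp x, tq pp x ≠ 0)
      (htq1 : ∀ (pp : Nat.Primes) (x : (thetaIndex X).Fibre (.inr pp)),
          haveI : Fact (pp : ℕ).Prime := ⟨pp.2⟩; placeOf X pp.1 x ∉ X.S → ‖tq pp x‖ = 1)
      (_ : ∀ (pp : Nat.Primes) (x : (thetaIndex X).Fibre (.inr pp)),
          haveI : Fact (pp : ℕ).Prime := ⟨pp.2⟩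
          Real.log ‖tq pp x‖ = -(X.qPilot (placeOf X pp.1 x)) * logNorm F (placeOf X pp.1 x) /
            localDegree F (placeOf X pp.1 x)),
      (settingPrVolSharp X hlog M archPk archSub Ψ act Mmod region n lat sig split qData tq t htq0 htq1).ThetaFinite ∧
      BridgeHyps (settingPrVolSharp X hlog M archPk archSub Ψ act Mmod region n lat sig split qData tq t htq0 htq1) ∧
      ThetaRegionsAdm (settingPrVolSharp X hlog M archPk archSub Ψ act Mmod region n lat sig split qData tq t htq0 htq1) ∧
      (settingPrVolSharp X hlog M archPk archSub Ψ act Mmod region n lat sig split qData tq t htq0 htq1).negLogQ =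
          -FinDivisor.ndeg F X.qPilot ∧
      (settingPrVolSharp X hlog M archPk archSub Ψ act Mmod region n lat sig split qData tq t htq0 htq1).AbsLogQPos ∧
      ((settingPrVolSharp X hlog M archPk archSub Ψ act Mmod region n lat sig split qData tq t htq0 htq1).Statement ↔
        (((-FinDivisor.ndeg F X.qPilot : ℝ) : WithTop ℝ) ≤
          (settingPrVolSharp X hlog M archPk archSub Ψ act Mmod region n lat sig split qData tq t htq0 htq1).negLogTheta)) := by
  obtain ⟨t, ht0, ht⟩ := exists_realising_thetaIdeles X hdiv
  obtain ⟨tq, htq0, htq⟩ := exists_realising_qIdeles X hdiv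
  have ht1 : ∀ (pp : Nat.Primes) (i : Fin X.lstar) (x : (thetaIndex X).Fibre (.inr pp)),
      haveI : Fact (pp : ℕ).Prime := ⟨pp.2⟩; placeOf X pp.1 x ∉ X.S → ‖t pp i x‖ = 1 :=
    fun pp i x hx => norm_eq_one_of_realises X t ht0 ht pp i x hx
  have htq1 : ∀ (pp : Nat.Primes) (x : (thetaIndex X).Fibre (.inr pp)),
      haveI : Fact (pp : ℕ).Prime := ⟨pp.2⟩; placeOf X pp.1 x ∉ X.S → ‖tq pp x‖ = 1 :=
    fun pp x hx => qIdele_norm_eq_one_of_realises X tq htq0 htq pp x hx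
  exact ⟨t, tq, ht0, ht, htq0, htq1, htq,
    thetaFinite_settingPrVolSharp X hlog M archPk archSub Ψ act Mmod region n lat sig split qData t tq ht0 ht1 htq0 htq1,
    bridgeHyps_settingPrVolSharp_of_ideles X hlog M archPk archSub Ψ act Mmod region n lat sig split qData t tq ht0 ht1
      htq0 htq1,
    thetaRegionsAdm_settingPrVolSharp X hlog M archPk archSub Ψ act Mmod region n lat sig split qData t tq ht0 htq0 htq1,
    negLogQ_settingPrVolSharp X hlog M archPk archSub Ψ act Mmod region n lat sig split qData t tq htq0 htq1 htq,
    absLogQPos_settingPrVolSharp X hlog M archPk archSub Ψ act Mmod region n lat sig split qData t tq htq0 htq1 htq,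
    statement_settingPrVolSharp_iff X hlog M archPk archSub Ψ act Mmod region n lat sig split qData t tq ht0 ht1 htq0 htq1
      htq⟩

end Real

end Thm311

end IUTFork

end Summit.ABC

end
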